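import Mathlib.CategoryTheory.Action.Limits
import Mathlib.CategoryTheory.Action.Concrete
import Mathlib.CategoryTheory.Limits.FullSubcategory
import Mathlib.CategoryTheory.Limits.Types.Limits
import Mathlib.CategoryTheory.Limits.Types.Colimits
import Mathlib.Data.Countable.Basic
import Literature.AnabelianGeometry.SemiGraphs.Temperoids

/-!
# [SemiAnbd] Remark 3.1.2 / Proposition 3.2: `B^temp(φ)` is a morphism of temperoids — proof

Mochizuki, *Semi-graphs of anabelioids*, Publ. RIMS **42** (2006) 221–322, §3, Remark 3.1.2
(pp. 33–34) and Proposition 3.2 (p. 35) [cite: MochizukiSemiAnbd2006, Rmk 3.1.2 p.34]: "if `Π'` is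
also tempered, then any continuous homomorphism `Π → Π'` determines a morphism of connected
temperoids `B^temp(Π) → B^temp(Π')`", i.e. (Definition 3.1 (iii)) the pull-back functor
`B^temp(φ) : B^temp(Π') ⥤ B^temp(Π)` preserves finite limits and countable colimits.  Proof-only
companion (no definitions) of `Temperoids.lean` (p405231): it DISCHARGES the named fact
`ResIsTemperoidHom` exactly as typed there (node `SemiAnbd:Prop3.2`, first half).

Proof.  `B^temp(Π)` is the full subcategory of Mathlib's `Action (Type u) Π` on the countable
`Π`-sets with open stabilisers (`temperedAction`).  This property is closed under finite limits (a
limit cone is jointly injective on points, so the limit is countable and the stabiliser of a point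
is the finite intersection of the stabilisers of its projections) and under countable colimits (a
colimit cocone is jointly surjective on points, and stabilisers grow along equivariant maps), so
the inclusion creates — in particular preserves and reflects — these (co)limits; restriction of
scalars `Action.res φ` is the identity on underlying sets, hence preserves all (co)limits.  The
temperedness and second-countability hypotheses of the named fact are not needed.
-/

namespace Literature.AnabelianGeometry.SemiGraphs

open CategoryTheory CategoryTheory.Limits Topology

universe u

section Closure

variable {G : Type u} [Group G] [TopologicalSpace G]

omit [TopologicalSpace G] in
/-- Equivariance of a morphism of `G`-sets, pointwise. [folklore] -/
private theorem hom_ρ_apply {X Y : Action (Type u) G} (f : X ⟶ Y) (g : G) (x : X.V) :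
    f.hom (X.ρ g x) = Y.ρ g (f.hom x) := by
  have e := ConcreteCategory.congr_hom (f.comm g) x
  simpa only [types_comp_apply] using e

/-- `B^temp(Π)` is closed under finite limits of `Π`-sets: the point set of a finite limit of
countable `Π`-sets with open stabilisers is countable with open stabilisers (Definition 3.1 (iii):
morphisms of temperoids preserve finite limits). [cite: MochizukiSemiAnbd2006, Def 3.1(iii) p.33] -/
theorem temperedAction_of_isLimit {J : Type} [SmallCategory J] [FinCategory J]
    {K : J ⥤ Action (Type u) G} {c : Cone K} (hc : IsLimit c)
    (hK : ∀ j, temperedAction G (K.obj j)) : temperedAction G c.pt := by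
  have hc' := isLimitOfPreserves (Action.forget (Type u) G) hc
  have hinj : ∀ y y' : c.pt.V,
      (∀ j, (c.π.app j).hom y = (c.π.app j).hom y') → y = y' := by
    intro y y' h
    apply (Types.isLimitEquivSections hc').injective
    apply Subtype.ext
    funext j
    exact h j
  have hπ : ∀ (j : J) (g : G) (y : c.pt.V),
      (c.π.app j).hom (c.pt.ρ g y) = (K.obj j).ρ g ((c.π.app j).hom y) :=
    fun j g y => hom_ρ_apply (c.π.app j) g y
  refine ⟨?_, fun x => ?_⟩
  · haveI : ∀ j, Countable (K.obj j).V := fun j => (hK j).1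
    have hf : Function.Injective (fun (y : c.pt.V) (j : J) => ((c.π.app j).hom y : (K.obj j).V)) :=
      fun y y' h => hinj y y' fun j => congrFun h j
    exact hf.countable
  · have heq : {g : G | c.pt.ρ g x = x} =
        ⋂ j, {g : G | (K.obj j).ρ g ((c.π.app j).hom x) = (c.π.app j).hom x} := by
      ext g
      simp only [Set.mem_setOf_eq, Set.mem_iInter]
      constructor
      · intro h j
        rw [← hπ, h]
      · intro h
        exact hinj _ _ fun j => by rw [hπ]; exact h j
    rw [heq]
    exact isOpen_iInter_of_finite fun j => (hK j).2 _

/-- `B^temp(Π)` is closed under countable colimits of `Π`-sets (for a topological group `Π`): a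
countable colimit of countable `Π`-sets with open stabilisers is countable with open stabilisers
(Definition 3.1 (iii): morphisms of temperoids preserve countable colimits).
[cite: MochizukiSemiAnbd2006, Def 3.1(iii) p.33] -/
theorem temperedAction_of_isColimit [IsTopologicalGroup G] {J : Type} [SmallCategory J]
    [CountableCategory J] {K : J ⥤ Action (Type u) G} {c : Cocone K} (hc : IsColimit c)
    (hK : ∀ j, temperedAction G (K.obj j)) : temperedAction G c.pt := by
  have hc' := isColimitOfPreserves (Action.forget (Type u) G) hc
  have hsurj : ∀ x : c.pt.V, ∃ (j : J) (y : (K.obj j).V), (c.ι.app j).hom y = x := fun x =>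
    Types.jointly_surjective_of_isColimit hc' x
  have hι : ∀ (j : J) (g : G) (y : (K.obj j).V),
      (c.ι.app j).hom ((K.obj j).ρ g y) = c.pt.ρ g ((c.ι.app j).hom y) :=
    fun j g y => hom_ρ_apply (c.ι.app j) g y
  refine ⟨?_, fun x => ?_⟩
  · haveI : ∀ j, Countable (K.obj j).V := fun j => (hK j).1
    have hf : Function.Surjective (β := c.pt.V)
        (fun p : Σ j, (K.obj j).V => (c.ι.app p.1).hom p.2) := by
      intro x
      obtain ⟨j, y, h⟩ := hsurj x
      exact ⟨⟨j, y⟩, h⟩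
    exact hf.countable
  · obtain ⟨j, y, hy⟩ := hsurj x
    letI : MulAction G (K.obj j).V := Action.instMulAction (K.obj j)
    letI : MulAction G c.pt.V := Action.instMulAction c.pt
    have hle : MulAction.stabilizer G y ≤ MulAction.stabilizer G x := by
      intro g hg
      rw [MulAction.mem_stabilizer_iff] at hg ⊢
      change c.pt.ρ g x = x
      have hg' : (K.obj j).ρ g y = y := hg
      rw [← hy, ← hι, hg']
    exact Subgroup.isOpen_mono hle ((hK j).2 y)

/-- `B^temp(Π)` is closed under finite limits, as an object property of `Action (Type u) Π`.
[cite: MochizukiSemiAnbd2006, Def 3.1(iii) p.33] -/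
theorem temperedAction_isClosedUnderLimitsOfShape (J : Type) [SmallCategory J] [FinCategory J] :
    (temperedAction G).IsClosedUnderLimitsOfShape J :=
  ⟨fun _ hX => by
    obtain ⟨h⟩ := hX
    exact temperedAction_of_isLimit h.isLimit h.prop_diag_obj⟩

/-- `B^temp(Π)` is closed under countable colimits, as an object property of `Action (Type u) Π`.
[cite: MochizukiSemiAnbd2006, Def 3.1(iii) p.33] -/
theorem temperedAction_isClosedUnderColimitsOfShape [IsTopologicalGroup G] (J : Type)
    [SmallCategory J] [CountableCategory J] :
    (temperedAction G).IsClosedUnderColimitsOfShape J :=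
  ⟨fun _ hX => by
    obtain ⟨h⟩ := hX
    exact temperedAction_of_isColimit h.isColimit h.prop_diag_obj⟩

end Closure

section Res

variable {G : Type u} [Group G] [TopologicalSpace G] {H : Type u} [Group H] [TopologicalSpace H]

omit [TopologicalSpace G] [TopologicalSpace H] in
/-- Restriction of scalars is the identity on underlying sets, so it preserves limits of any
shape. [folklore] -/
private theorem res_preservesLimitsOfShape (φ : G →* H) (J : Type) [SmallCategory J] :
    PreservesLimitsOfShape J (Action.res (Type u) φ) :=
  Action.preservesLimitsOfShape_of_preserves _
    (preservesLimitsOfShape_of_natIso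
      (Iso.refl _ : Action.forget (Type u) H ≅ Action.res (Type u) φ ⋙ Action.forget (Type u) G))

omit [TopologicalSpace G] [TopologicalSpace H] in
/-- Restriction of scalars is the identity on underlying sets, so it preserves colimits of any
shape. [folklore] -/
private theorem res_preservesColimitsOfShape (φ : G →* H) (J : Type) [SmallCategory J] :
    PreservesColimitsOfShape J (Action.res (Type u) φ) :=
  Action.preservesColimitsOfShape_of_preserves _
    (preservesColimitsOfShape_of_natIso
      (Iso.refl _ : Action.forget (Type u) H ≅ Action.res (Type u) φ ⋙ Action.forget (Type u) G))

/-- `B^temp(φ)` preserves finite limits. [cite: MochizukiSemiAnbd2006, Rmk 3.1.2 p.34] -/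
theorem btempRes_preservesLimitsOfShape (φ : G →ₜ* H) (J : Type) [SmallCategory J]
    [FinCategory J] : PreservesLimitsOfShape J (BTemp.res φ) := by
  haveI := temperedAction_isClosedUnderLimitsOfShape (G := H) J
  haveI := res_preservesLimitsOfShape (G := G) φ.toMonoidHom J
  haveI : PreservesLimitsOfShape J (BTemp.res φ ⋙ (temperedAction G).ι) :=
    preservesLimitsOfShape_of_natIso
      (Iso.refl _ : (temperedAction H).ι ⋙ Action.res (Type u) φ.toMonoidHom ≅
        BTemp.res φ ⋙ (temperedAction G).ι)
  exact preservesLimitsOfShape_of_reflects_of_preserves (BTemp.res φ) (temperedAction G).ι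

/-- `B^temp(φ)` preserves countable colimits. [cite: MochizukiSemiAnbd2006, Rmk 3.1.2 p.34] -/
theorem btempRes_preservesColimitsOfShape [IsTopologicalGroup H] (φ : G →ₜ* H) (J : Type)
    [SmallCategory J] [CountableCategory J] : PreservesColimitsOfShape J (BTemp.res φ) := by
  haveI := temperedAction_isClosedUnderColimitsOfShape (G := H) J
  haveI := res_preservesColimitsOfShape (G := G) φ.toMonoidHom J
  haveI : PreservesColimitsOfShape J (BTemp.res φ ⋙ (temperedAction G).ι) :=
    preservesColimitsOfShape_of_natIso
      (Iso.refl _ : (temperedAction H).ι ⋙ Action.res (Type u) φ.toMonoidHom ≅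
        BTemp.res φ ⋙ (temperedAction G).ι)
  exact preservesColimitsOfShape_of_reflects_of_preserves (BTemp.res φ) (temperedAction G).ι

end Res

/-- [SemiAnbd] Remark 3.1.2 / Proposition 3.2 (first half) — DISCHARGED: for a continuous
homomorphism `φ : Π₁ → Π₂` the pull-back functor `B^temp(φ) : B^temp(Π₂) ⥤ B^temp(Π₁)` preserves
finite limits and countable colimits, i.e. is a morphism of connected temperoids
`B^temp(Π₁) → B^temp(Π₂)`. [cite: MochizukiSemiAnbd2006, Prop 3.2 p.35] -/
theorem ResIsTemperoidHom_holds : ∀ (G₁ : Type u) [Group G₁] [TopologicalSpace G₁]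
    (G₂ : Type u) [Group G₂] [TopologicalSpace G₂], ResIsTemperoidHom G₁ G₂ := by
  intro G₁ _ _ G₂ _ _ _ _ _ _ _ _ φ
  exact ⟨⟨fun J _ _ => btempRes_preservesLimitsOfShape φ J⟩,
    fun J _ _ => btempRes_preservesColimitsOfShape φ J⟩

end Literature.AnabelianGeometry.SemiGraphs
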